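import Literature.Topology.FourManifolds.HandleSlabSet
import HarnessLib

/-!
# Kosinski's handle presentation theorem (VII 2.2), Part 5c: the base reparametrisation
# `M ∖ ⋃ h(S) → {F ≤ c - ε}` in `W` and its inverse

Topic `Literature/Topology/FourManifolds`; continuation of `HandleSlabLevel.lean` (Parts 2–4) and
`HandleSlabSet.lean` (Part 5a) of the formalisation of Kosinski, *Differential Manifolds* (1993),
VII Prop. 2.2, in the tree's model `HandleAttachingMap.IsMultiAttachment` of handle attachment.

Kosinski (PDF p. 101, (2.2.6)–(2.2.7)): the diffeomorphism `g : M ∪ H^λ → F⁻¹(-∞, -ε]` is, on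
`M ∖ h(S^{λ-1})`, the map `σ` — the identity outside the tube and a radial reparametrisation of the
base near the attaching sphere.  In the `T(0)` convention of the tree this is the model map
`Θ = HandleSlab.baseMap` of Part 2 (the identity for `|x_λ|² ≥ ε/4 + W ε`, `baseMap_eq_self`).
This file assembles it on `W`: **`SlabData.baseAmb`** is `φᵢ⁻¹ ∘ Θ ∘ φᵢ` over the balls `K i`
carrying the bumps and the identity elsewhere (the two agree where they overlap, Θ being the
identity near `∂K i ∩ M`), together with its inverse **`SlabData.baseInvAmb`** (`Θ⁻¹ = baseInv`
over the balls).  We prove: on the body off the attaching spheres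
(`f q ≤ c - ε`, `|φᵢ(q)_λ|² ≠ ε`) `baseAmb` takes values in the slab `{F ≤ c - ε}`, level to level
(`F_baseAmb_le`), is `C^∞` (`contMDiffAt_baseAmb`) and is inverted by `baseInvAmb`
(`baseInvAmb_baseAmb`); on the slab off the belt discs (`F x ≤ c - ε`, `|φᵢ(x)_λ|² ≠ 0`)
`baseInvAmb` takes values in the body off the attaching spheres, is `C^∞` and is inverted by
`baseAmb`.  The embedding `M ∖ ⋃ᵢ hᵢ(S) ↪ {F ≤ c - ε}` of manifolds with boundary is packaged in
`HandleSlabBasePiece.lean`.  Everything here is proved; no named facts are introduced.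

## References

* A. A. Kosinski, *Differential Manifolds*, Academic Press (1993), VII §2, proof of Prop. 2.2,
  (2.2.6)–(2.2.7) (PDF p. 101); VI §6. [Kosinski1993]
-/

open scoped Manifold ContDiff Topology
open Set Function Metric Real Filter

noncomputable section

universe u

namespace Literature.Topology.FourManifolds

open HandleShrink HandleSlab

namespace HandleSlab

variable {m k : ℕ} {ε : ℝ}

/-- **`Θ⁻¹` is the identity on `{|x_λ|² ≥ ε/4 + W ε}`** (as `Θ` is). [cite: Kosinski1993, VII (2.2.7)] -/
theorem baseInv_eq_self (hε : 0 < ε) {x : EuclideanSpace ℝ (Fin m)}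
    (hL : ε / 4 + width * ε ≤ lamSq k x) : baseInv ε k x = x := by
  have hεL : ε < lamSq k x := by nlinarith [ten_le_width]
  conv_lhs => rw [← baseMap_eq_self hε hL]
  exact baseInv_baseMap hε hεL

end HandleSlab

namespace SlabData

variable {n : ℕ} {W : Type u} [TopologicalSpace W] [ChartedSpace (EuclideanHalfSpace (n + 1)) W]
  {ι : Type*} (D : SlabData n W ι)

/-! ### §1 The ball containing a point; the two piecewise maps -/

/-- A point lies in at most one of the balls `K i`. [folklore] -/
theorem eq_of_mem_K_of_mem_K {i j : ι} {q : W} (hi : q ∈ D.K i) (hj : q ∈ D.K j) : i = j := by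
  by_contra hne
  exact Set.disjoint_left.1 (D.disjoint_K hne) hi hj

/-- A point lies in at most one chart source. [folklore] -/
theorem eq_of_mem_source_of_mem_source {i j : ι} {q : W} (hi : q ∈ (D.φ i).source)
    (hj : q ∈ (D.φ j).source) : i = j := by
  by_contra hne
  exact Set.disjoint_left.1 (D.disjoint hne) hi hj

open Classical in
/-- **Kosinski's `σ` on `W`**: `φᵢ⁻¹ ∘ Θ ∘ φᵢ` over the ball `K i`, the identity off the balls.
[cite: Kosinski1993, VII (2.2.7)] -/
def baseAmb (q : W) : W :=
  if h : ∃ i, q ∈ D.K i then (D.φ h.choose).symm (baseMap D.ε D.lam (D.φ h.choose q)) else q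

open Classical in
/-- **The inverse of `σ` on `W`**: `φᵢ⁻¹ ∘ Θ⁻¹ ∘ φᵢ` over the ball `K i`, the identity off the
balls. [cite: Kosinski1993, VII (2.2.7)] -/
def baseInvAmb (x : W) : W :=
  if h : ∃ i, x ∈ D.K i then (D.φ h.choose).symm (baseInv D.ε D.lam (D.φ h.choose x)) else x

/-- `σ` over the ball `K i`. [folklore] -/
theorem baseAmb_of_mem_K {i : ι} {q : W} (hq : q ∈ D.K i) :
    D.baseAmb q = (D.φ i).symm (baseMap D.ε D.lam (D.φ i q)) := by
  classical
  have h : ∃ j, q ∈ D.K j := ⟨i, hq⟩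
  rw [baseAmb, dif_pos h, D.eq_of_mem_K_of_mem_K h.choose_spec hq]

/-- `σ` off the balls. [folklore] -/
theorem baseAmb_of_not_mem {q : W} (hq : q ∉ ⋃ i, D.K i) : D.baseAmb q = q := by
  classical
  have h : ¬ ∃ j, q ∈ D.K j := fun ⟨j, hj⟩ => hq (mem_iUnion.2 ⟨j, hj⟩)
  rw [baseAmb, dif_neg h]

/-- `σ⁻¹` over the ball `K i`. [folklore] -/
theorem baseInvAmb_of_mem_K {i : ι} {x : W} (hx : x ∈ D.K i) :
    D.baseInvAmb x = (D.φ i).symm (baseInv D.ε D.lam (D.φ i x)) := by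
  classical
  have h : ∃ j, x ∈ D.K j := ⟨i, hx⟩
  rw [baseInvAmb, dif_pos h, D.eq_of_mem_K_of_mem_K h.choose_spec hx]

/-- `σ⁻¹` off the balls. [folklore] -/
theorem baseInvAmb_of_not_mem {x : W} (hx : x ∉ ⋃ i, D.K i) : D.baseInvAmb x = x := by
  classical
  have h : ¬ ∃ j, x ∈ D.K j := fun ⟨j, hj⟩ => hx (mem_iUnion.2 ⟨j, hj⟩)
  rw [baseInvAmb, dif_neg h]

/-- **The identity zone**: `σ q = q` for `q` in the `i`-th chart with `|x_λ|² ≥ ε/4 + W ε`.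
[cite: Kosinski1993, VII (2.2.7)] -/
theorem baseAmb_eq_self_of_le {i : ι} {q : W} (hq : q ∈ (D.φ i).source)
    (hL : D.ε / 4 + width * D.ε ≤ lamSq D.lam (D.φ i q)) : D.baseAmb q = q := by
  by_cases h : q ∈ ⋃ j, D.K j
  · obtain ⟨j, hj⟩ := mem_iUnion.1 h
    have hji : j = i := D.eq_of_mem_source_of_mem_source (D.K_subset_source j hj) hq
    subst hji
    rw [D.baseAmb_of_mem_K hj, baseMap_eq_self D.ε_pos hL, (D.φ j).left_inv hq]
  · exact D.baseAmb_of_not_mem h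

/-- The identity zone of `σ⁻¹`. [cite: Kosinski1993, VII (2.2.7)] -/
theorem baseInvAmb_eq_self_of_le {i : ι} {x : W} (hx : x ∈ (D.φ i).source)
    (hL : D.ε / 4 + width * D.ε ≤ lamSq D.lam (D.φ i x)) : D.baseInvAmb x = x := by
  by_cases h : x ∈ ⋃ j, D.K j
  · obtain ⟨j, hj⟩ := mem_iUnion.1 h
    have hji : j = i := D.eq_of_mem_source_of_mem_source (D.K_subset_source j hj) hx
    subst hji
    rw [D.baseInvAmb_of_mem_K hj, baseInv_eq_self D.ε_pos hL, (D.φ j).left_inv hx]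
  · exact D.baseInvAmb_of_not_mem h

/-- `B ε` lies above the identity threshold `ε/4 + W ε`. [folklore] -/
theorem threshold_le_outer : D.ε / 4 + width * D.ε ≤ outer * D.ε := by
  rw [support_end_eq]; nlinarith [D.ε_pos]

/-- **Off the attaching sphere, body points of the `i`-th chart have `ε < |x_λ|²`.** [folklore] -/
theorem lt_lamSq_of_ne {i : ι} {q : W} (hs : q ∈ (D.φ i).source) (hq : D.f q ≤ D.c - D.ε)
    (hc : lamSq D.lam (D.φ i q) ≠ D.ε) : D.ε < lamSq D.lam (D.φ i q) := by
  have hm := D.muSq_le_of_mem_bodySet hs hq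
  exact lt_of_le_of_ne (by linarith [muSq_nonneg D.lam (D.φ i q)]) (Ne.symm hc)

/-- A body point of the `i`-th chart with `|x_λ|² ≤ B ε` has `‖x‖² < (2B + 1) ε` unless … indeed
always `‖x‖² ≤ 2|x_λ|² - ε < 2 B ε`. [folklore] -/
theorem norm_sq_lt_of_f_le {i : ι} {q : W} (hs : q ∈ (D.φ i).source) (hq : D.f q ≤ D.c - D.ε)
    (hL : lamSq D.lam (D.φ i q) < outer * D.ε) : ‖D.φ i q‖ ^ 2 < (2 * outer + 1) * D.ε := by
  have hm := D.muSq_le_of_mem_bodySet hs hq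
  rw [← lamSq_add_muSq D.lam]; nlinarith [D.ε_pos]

/-- Body points of the `i`-th chart with `|x_λ|² < B ε` lie in `K i`. [folklore] -/
theorem mem_K_of_f_le {i : ι} {q : W} (hs : q ∈ (D.φ i).source) (hq : D.f q ≤ D.c - D.ε)
    (hL : lamSq D.lam (D.φ i q) < outer * D.ε) : q ∈ D.K i := by
  have h := D.symm_mem_K_of_norm_sq_lt i (D.norm_sq_lt_of_f_le hs hq hL)
  rwa [(D.φ i).left_inv hs] at h

/-! ### §2 `σ` on the body off the attaching spheres -/

/-- **`σ` over the tube region** `ε < |x_λ|² < B ε` of the body: it stays in the `i`-th chart,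
with chart value `Θ (φᵢ q)`, inside `K i`. [cite: Kosinski1993, VII (2.2.7)] -/
theorem baseAmb_chart {i : ι} {q : W} (hs : q ∈ (D.φ i).source) (hq : D.f q ≤ D.c - D.ε)
    (hL : D.ε < lamSq D.lam (D.φ i q)) (hL' : lamSq D.lam (D.φ i q) < outer * D.ε) :
    D.baseAmb q ∈ (D.φ i).source ∧ D.φ i (D.baseAmb q) = baseMap D.ε D.lam (D.φ i q) ∧
      D.baseAmb q ∈ D.K i := by
  have hm := D.muSq_le_of_mem_bodySet hs hq
  have hn := norm_baseMap_sq_lt D.ε_pos hL hL' hm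
  have hK := D.mem_K_of_f_le hs hq hL'
  rw [D.baseAmb_of_mem_K hK]
  exact ⟨(D.φ i).map_target (D.mem_target_of_norm_sq_lt i hn),
    (D.φ i).right_inv (D.mem_target_of_norm_sq_lt i hn), D.symm_mem_K_of_norm_sq_lt i hn⟩

variable [Fintype ι]

/-- **`σ` maps the body off the attaching spheres into the slab, level to level**:
`F (σ q) ≤ c - ε`, with equality iff `f q = c - ε`. [cite: Kosinski1993, VII (2.2.7)] -/
theorem F_baseAmb_le {q : W} (hq : D.f q ≤ D.c - D.ε)
    (hc : ∀ i, q ∈ (D.φ i).source → lamSq D.lam (D.φ i q) ≠ D.ε) :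
    D.F (D.baseAmb q) ≤ D.c - D.ε ∧ (D.F (D.baseAmb q) = D.c - D.ε ↔ D.f q = D.c - D.ε) := by
  by_cases h : q ∈ ⋃ j, D.K j
  · obtain ⟨i, hi⟩ := mem_iUnion.1 h
    have hs := D.K_subset_source i hi
    have hL := D.lt_lamSq_of_ne hs hq (hc i hs)
    by_cases hL' : lamSq D.lam (D.φ i q) < outer * D.ε
    · obtain ⟨hs', hφ, -⟩ := D.baseAmb_chart hs hq hL hL'
      have hm := D.muSq_le_of_mem_bodySet hs hq
      obtain ⟨hle, hiff⟩ := muSq_baseMap_le D.ε_pos hL hm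
      have hLA : lamSq D.lam (D.φ i (D.baseAmb q)) < outer * D.ε := by
        rw [hφ]; exact (lamSq_baseMap_mem D.ε_pos hL hL').2
      refine ⟨(D.F_le_iff_muSq_le hs' hLA).2 (by rw [hφ]; exact hle), ?_⟩
      rw [D.F_eq_iff_muSq_eq hs' hLA, hφ, hiff, D.f_eq_of_mem_source hs]
      constructor <;> intro h' <;> linarith
    · have hge : outer * D.ε ≤ lamSq D.lam (D.φ i q) := not_lt.1 hL'
      rw [D.baseAmb_eq_self_of_le hs (D.threshold_le_outer.trans hge), D.F_eq_f_of_outer_le hs hge]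
      exact ⟨hq, Iff.rfl⟩
  · rw [D.baseAmb_of_not_mem h, D.F_eq_of_not_mem h]
    exact ⟨hq, Iff.rfl⟩

/-- **`σ` is smooth at the points of the body off the attaching spheres.** Over the open part
`‖φᵢ‖ < ρ₀` of `K i` it is `φᵢ⁻¹ ∘ Θ ∘ φᵢ` (`Θ` smooth for `ε < |x_λ|²`); at the remaining
points it is the identity nearby (on `∂K i` the body has `|x_λ|² ≥ (B + 2) ε`, inside the
identity zone). [cite: Kosinski1993, VII (2.2.7)] -/
theorem contMDiffAt_baseAmb [IsManifold (𝓡∂ (n + 1)) ∞ W] [T2Space W] {q : W}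
    (hq : D.f q ≤ D.c - D.ε) (hc : ∀ i, q ∈ (D.φ i).source → lamSq D.lam (D.φ i q) ≠ D.ε) :
    ContMDiffAt (𝓡∂ (n + 1)) (𝓡∂ (n + 1)) ∞ D.baseAmb q := by
  by_cases h : q ∈ ⋃ j, D.K j
  · obtain ⟨i, hi⟩ := mem_iUnion.1 h
    have hs := D.K_subset_source i hi
    have hL := D.lt_lamSq_of_ne hs hq (hc i hs)
    have hρ := D.norm_le_of_mem_K hi
    rcases hρ.lt_or_eq with hlt | heq
    · -- chart formula on the open set `{q ∈ source | ε < |x_λ|², ‖φ q‖ < ρ₀}`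
      have hO : IsOpen ((D.φ i).source ∩ D.φ i ⁻¹' {x | D.ε < lamSq D.lam x ∧ ‖x‖ < D.ρ₀}) :=
        (D.φ i).isOpen_inter_preimage ((isOpen_lt continuous_const (continuous_lamSq D.lam)).inter
          (isOpen_lt continuous_norm continuous_const))
      have hev : D.baseAmb =ᶠ[𝓝 q] fun q' => (D.φ i).symm (baseMap D.ε D.lam (D.φ i q')) :=
        eventuallyEq_of_mem (hO.mem_nhds ⟨hs, hL, hlt⟩) fun q' hq' =>
          D.baseAmb_of_mem_K (D.mem_K_of_norm_le hq'.1 hq'.2.2.le)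
      refine ContMDiffAt.congr_of_eventuallyEq ?_ hev
      have h1 : ContMDiffAt (𝓡∂ (n + 1)) 𝓘(ℝ, EuclideanSpace ℝ (Fin (n + 1))) ∞ (D.φ i) q :=
        (D.chart i).contMDiffOn_toFun.contMDiffAt ((D.φ i).open_source.mem_nhds hs)
      have h2 : ContMDiffAt (𝓡∂ (n + 1)) 𝓘(ℝ, EuclideanSpace ℝ (Fin (n + 1))) ∞
          (fun q' => baseMap D.ε D.lam (D.φ i q')) q :=
        (contDiffAt_baseMap D.ε_pos hL).contMDiffAt.comp q h1
      by_cases hL' : lamSq D.lam (D.φ i q) < outer * D.ε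
      · have hm := D.muSq_le_of_mem_bodySet hs hq
        have ht := D.mem_target_of_norm_sq_lt i (norm_baseMap_sq_lt D.ε_pos hL hL' hm)
        exact ((D.chart i).contMDiffOn_symm.contMDiffAt ((D.φ i).open_target.mem_nhds ht)).comp q h2
      · have hge : outer * D.ε ≤ lamSq D.lam (D.φ i q) := not_lt.1 hL'
        have ht : baseMap D.ε D.lam (D.φ i q) ∈ (D.φ i).target := by
          rw [baseMap_eq_self D.ε_pos (D.threshold_le_outer.trans hge)]; exact (D.φ i).map_source hs
        exact ((D.chart i).contMDiffOn_symm.contMDiffAt ((D.φ i).open_target.mem_nhds ht)).comp q h2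
    · -- on `∂K i`: the identity nearby
      have hm := D.muSq_le_of_mem_bodySet hs hq
      have hsum := lamSq_add_muSq D.lam (D.φ i q)
      rw [heq, D.ρ₀_sq] at hsum
      have hbig : D.ε / 4 + width * D.ε < lamSq D.lam (D.φ i q) := by
        rw [support_end_eq]; nlinarith [D.ε_pos, outer_pos]
      have hO : IsOpen ((D.φ i).source ∩ D.φ i ⁻¹' {x | D.ε / 4 + width * D.ε < lamSq D.lam x}) :=
        (D.φ i).isOpen_inter_preimage (isOpen_lt continuous_const (continuous_lamSq D.lam))
      have hev : D.baseAmb =ᶠ[𝓝 q] id :=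
        eventuallyEq_of_mem (hO.mem_nhds ⟨hs, hbig⟩) fun q' hq' => D.baseAmb_eq_self_of_le hq'.1 hq'.2.le
      exact contMDiffAt_id.congr_of_eventuallyEq hev
  · have hev : D.baseAmb =ᶠ[𝓝 q] id :=
      eventuallyEq_of_mem (D.isClosed_iUnion_K.isOpen_compl.mem_nhds h) fun q' hq' =>
        D.baseAmb_of_not_mem hq'
    exact contMDiffAt_id.congr_of_eventuallyEq hev

/-! ### §3 `σ⁻¹` on the slab off the belt discs -/

/-- **`σ⁻¹` over the handle region** `0 < |x_λ|² < B ε` of the slab: it stays in the `i`-th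
chart, with chart value `Θ⁻¹ (φᵢ x)`, inside `K i`, in the body off the attaching sphere.
[cite: Kosinski1993, VII (2.2.7)] -/
theorem baseInvAmb_chart {i : ι} {x : W} (hs : x ∈ (D.φ i).source) (hx : D.F x ≤ D.c - D.ε)
    (h0 : 0 < lamSq D.lam (D.φ i x)) (hL' : lamSq D.lam (D.φ i x) < outer * D.ε) :
    D.baseInvAmb x ∈ (D.φ i).source ∧ D.φ i (D.baseInvAmb x) = baseInv D.ε D.lam (D.φ i x) ∧
      D.baseInvAmb x ∈ D.K i ∧ D.f (D.baseInvAmb x) ≤ D.c - D.ε ∧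
      D.ε < lamSq D.lam (D.φ i (D.baseInvAmb x)) ∧
      lamSq D.lam (D.φ i (D.baseInvAmb x)) < outer * D.ε := by
  have hm := (D.F_le_iff_muSq_le hs hL').1 hx
  obtain ⟨hIε, hIB, hIm⟩ := baseInv_mem D.ε_pos h0 hL' hm
  have hn : ‖baseInv D.ε D.lam (D.φ i x)‖ ^ 2 < (2 * outer + 1) * D.ε := by
    rw [← lamSq_add_muSq D.lam]; nlinarith [D.ε_pos]
  have hK := D.mem_K_of_F_le hs hL' hx
  have ht := D.mem_target_of_norm_sq_lt i hn
  rw [D.baseInvAmb_of_mem_K hK]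
  refine ⟨(D.φ i).map_target ht, (D.φ i).right_inv ht, D.symm_mem_K_of_norm_sq_lt i hn, ?_, ?_, ?_⟩
  · rw [D.f_eq_of_mem_source ((D.φ i).map_target ht), (D.φ i).right_inv ht]; linarith
  · rw [(D.φ i).right_inv ht]; exact hIε
  · rw [(D.φ i).right_inv ht]; exact hIB

/-- A slab point of the `i`-th chart on the attaching level `|x_λ|² = ε`… cannot occur off the
balls: **off `⋃ K i`, slab points are body points off the attaching spheres.** [folklore] -/
theorem lamSq_ne_of_not_mem {x : W} (hK : x ∉ ⋃ i, D.K i) (hx : D.F x ≤ D.c - D.ε) (i : ι)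
    (hs : x ∈ (D.φ i).source) : lamSq D.lam (D.φ i x) ≠ D.ε := by
  intro hL
  have hq := D.f_le_of_F_le_of_not_mem hK hx
  have hL' : lamSq D.lam (D.φ i x) < outer * D.ε := by rw [hL]; nlinarith [D.ε_pos, one_lt_outer]
  exact hK (mem_iUnion.2 ⟨i, D.mem_K_of_f_le hs hq hL'⟩)

/-- **`σ⁻¹` maps the slab off the belt discs into the body off the attaching spheres.**
[cite: Kosinski1993, VII (2.2.7)] -/
theorem f_baseInvAmb_le {x : W} (hx : D.F x ≤ D.c - D.ε)
    (h0 : ∀ i, x ∈ (D.φ i).source → lamSq D.lam (D.φ i x) ≠ 0) :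
    D.f (D.baseInvAmb x) ≤ D.c - D.ε ∧
      ∀ i, D.baseInvAmb x ∈ (D.φ i).source → lamSq D.lam (D.φ i (D.baseInvAmb x)) ≠ D.ε := by
  by_cases h : x ∈ ⋃ j, D.K j
  · obtain ⟨i, hi⟩ := mem_iUnion.1 h
    have hs := D.K_subset_source i hi
    have hpos : 0 < lamSq D.lam (D.φ i x) := lt_of_le_of_ne (lamSq_nonneg _ _) (Ne.symm (h0 i hs))
    by_cases hL' : lamSq D.lam (D.φ i x) < outer * D.ε
    · obtain ⟨hs', -, -, hf, hε, -⟩ := D.baseInvAmb_chart hs hx hpos hL'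
      refine ⟨hf, fun j hj => ?_⟩
      have hji : j = i := D.eq_of_mem_source_of_mem_source hj hs'
      subst hji
      exact hε.ne'
    · have hge : outer * D.ε ≤ lamSq D.lam (D.φ i x) := not_lt.1 hL'
      rw [D.baseInvAmb_eq_self_of_le hs (D.threshold_le_outer.trans hge)]
      refine ⟨D.f_le_of_F_le_of_outer_le hs hge hx, fun j hj => ?_⟩
      have hji : j = i := D.eq_of_mem_source_of_mem_source hj hs
      subst hji
      intro hL; rw [hL] at hge; nlinarith [D.ε_pos, one_lt_outer]
  · rw [D.baseInvAmb_of_not_mem h]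
    exact ⟨D.f_le_of_F_le_of_not_mem h hx, D.lamSq_ne_of_not_mem h hx⟩

omit [Fintype ι] in
/-- **`σ⁻¹ ∘ σ = id` on the body off the attaching spheres.** [cite: Kosinski1993, VII (2.2.7)] -/
theorem baseInvAmb_baseAmb {q : W} (hq : D.f q ≤ D.c - D.ε)
    (hc : ∀ i, q ∈ (D.φ i).source → lamSq D.lam (D.φ i q) ≠ D.ε) : D.baseInvAmb (D.baseAmb q) = q := by
  by_cases h : q ∈ ⋃ j, D.K j
  · obtain ⟨i, hi⟩ := mem_iUnion.1 h
    have hs := D.K_subset_source i hi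
    have hL := D.lt_lamSq_of_ne hs hq (hc i hs)
    by_cases hL' : lamSq D.lam (D.φ i q) < outer * D.ε
    · obtain ⟨hs', hφ, hK⟩ := D.baseAmb_chart hs hq hL hL'
      rw [D.baseInvAmb_of_mem_K hK, hφ, baseInv_baseMap D.ε_pos hL, (D.φ i).left_inv hs]
    · have hge : outer * D.ε ≤ lamSq D.lam (D.φ i q) := not_lt.1 hL'
      rw [D.baseAmb_eq_self_of_le hs (D.threshold_le_outer.trans hge),
        D.baseInvAmb_eq_self_of_le hs (D.threshold_le_outer.trans hge)]
  · rw [D.baseAmb_of_not_mem h, D.baseInvAmb_of_not_mem h]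

/-- **`σ ∘ σ⁻¹ = id` on the slab off the belt discs.** [cite: Kosinski1993, VII (2.2.7)] -/
theorem baseAmb_baseInvAmb {x : W} (hx : D.F x ≤ D.c - D.ε)
    (h0 : ∀ i, x ∈ (D.φ i).source → lamSq D.lam (D.φ i x) ≠ 0) : D.baseAmb (D.baseInvAmb x) = x := by
  by_cases h : x ∈ ⋃ j, D.K j
  · obtain ⟨i, hi⟩ := mem_iUnion.1 h
    have hs := D.K_subset_source i hi
    have hpos : 0 < lamSq D.lam (D.φ i x) := lt_of_le_of_ne (lamSq_nonneg _ _) (Ne.symm (h0 i hs))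
    by_cases hL' : lamSq D.lam (D.φ i x) < outer * D.ε
    · obtain ⟨hs', hφ, hK, -⟩ := D.baseInvAmb_chart hs hx hpos hL'
      rw [D.baseAmb_of_mem_K hK, hφ, baseMap_baseInv D.ε_pos hpos hL', (D.φ i).left_inv hs]
    · have hge : outer * D.ε ≤ lamSq D.lam (D.φ i x) := not_lt.1 hL'
      rw [D.baseInvAmb_eq_self_of_le hs (D.threshold_le_outer.trans hge),
        D.baseAmb_eq_self_of_le hs (D.threshold_le_outer.trans hge)]
  · rw [D.baseInvAmb_of_not_mem h, D.baseAmb_of_not_mem h]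

/-- **`σ⁻¹` is smooth at the points of the slab off the belt discs** (chart formula over the
open part of `K i`, the identity near the remaining points). [cite: Kosinski1993, VII (2.2.7)] -/
theorem contMDiffAt_baseInvAmb [IsManifold (𝓡∂ (n + 1)) ∞ W] [T2Space W] {x : W}
    (hx : D.F x ≤ D.c - D.ε) (h0 : ∀ i, x ∈ (D.φ i).source → lamSq D.lam (D.φ i x) ≠ 0) :
    ContMDiffAt (𝓡∂ (n + 1)) (𝓡∂ (n + 1)) ∞ D.baseInvAmb x := by
  by_cases h : x ∈ ⋃ j, D.K j
  · obtain ⟨i, hi⟩ := mem_iUnion.1 h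
    have hs := D.K_subset_source i hi
    have hpos : 0 < lamSq D.lam (D.φ i x) := lt_of_le_of_ne (lamSq_nonneg _ _) (Ne.symm (h0 i hs))
    have hρ := D.norm_le_of_mem_K hi
    by_cases hL' : lamSq D.lam (D.φ i x) < outer * D.ε
    · -- then `‖φ x‖² < (2B + 1) ε < ρ₀²`: chart formula nearby
      have hlt : ‖D.φ i x‖ < D.ρ₀ := by
        have h1 := D.norm_sq_lt_of_F_le hs hL' hx
        have h2 := D.ρ₀_sq
        nlinarith [norm_nonneg (D.φ i x), Real.sqrt_nonneg ((2 * outer + 3) * D.ε), D.ε_pos]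
      have hO : IsOpen ((D.φ i).source ∩ D.φ i ⁻¹'
          {y | (0 < lamSq D.lam y ∧ lamSq D.lam y < outer * D.ε) ∧ ‖y‖ < D.ρ₀}) :=
        (D.φ i).isOpen_inter_preimage (((isOpen_lt continuous_const (continuous_lamSq D.lam)).inter
          (isOpen_lt (continuous_lamSq D.lam) continuous_const)).inter
          (isOpen_lt continuous_norm continuous_const))
      have hev : D.baseInvAmb =ᶠ[𝓝 x] fun x' => (D.φ i).symm (baseInv D.ε D.lam (D.φ i x')) :=
        eventuallyEq_of_mem (hO.mem_nhds ⟨hs, ⟨hpos, hL'⟩, hlt⟩) fun x' hx' =>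
          D.baseInvAmb_of_mem_K (D.mem_K_of_norm_le hx'.1 hx'.2.2.le)
      refine ContMDiffAt.congr_of_eventuallyEq ?_ hev
      have h1 : ContMDiffAt (𝓡∂ (n + 1)) 𝓘(ℝ, EuclideanSpace ℝ (Fin (n + 1))) ∞ (D.φ i) x :=
        (D.chart i).contMDiffOn_toFun.contMDiffAt ((D.φ i).open_source.mem_nhds hs)
      have h2 : ContMDiffAt (𝓡∂ (n + 1)) 𝓘(ℝ, EuclideanSpace ℝ (Fin (n + 1))) ∞
          (fun x' => baseInv D.ε D.lam (D.φ i x')) x :=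
        (contDiffAt_baseInv D.ε_pos hpos hL').contMDiffAt.comp x h1
      obtain ⟨hs', hφ, -⟩ := D.baseInvAmb_chart hs hx hpos hL'
      have ht : baseInv D.ε D.lam (D.φ i x) ∈ (D.φ i).target := by
        rw [← hφ]; exact (D.φ i).map_source hs'
      exact ((D.chart i).contMDiffOn_symm.contMDiffAt ((D.φ i).open_target.mem_nhds ht)).comp x h2
    · -- identity zone nearby
      have hge : outer * D.ε ≤ lamSq D.lam (D.φ i x) := not_lt.1 hL'
      have hbig : D.ε / 4 + width * D.ε < lamSq D.lam (D.φ i x) := by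
        rw [support_end_eq]; nlinarith [D.ε_pos]
      have hO : IsOpen ((D.φ i).source ∩ D.φ i ⁻¹' {y | D.ε / 4 + width * D.ε < lamSq D.lam y}) :=
        (D.φ i).isOpen_inter_preimage (isOpen_lt continuous_const (continuous_lamSq D.lam))
      have hev : D.baseInvAmb =ᶠ[𝓝 x] id :=
        eventuallyEq_of_mem (hO.mem_nhds ⟨hs, hbig⟩) fun x' hx' =>
          D.baseInvAmb_eq_self_of_le hx'.1 hx'.2.le
      exact contMDiffAt_id.congr_of_eventuallyEq hev
  · have hev : D.baseInvAmb =ᶠ[𝓝 x] id :=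
      eventuallyEq_of_mem (D.isClosed_iUnion_K.isOpen_compl.mem_nhds h) fun x' hx' =>
        D.baseInvAmb_of_not_mem hx'
    exact contMDiffAt_id.congr_of_eventuallyEq hev

end SlabData

end Literature.Topology.FourManifolds
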